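/-
Copyright (c) 2026 the pub-hodgecm-mathlib formalisation cell (harness21).  Prover seat hodgecm-mathlib-LH7-p04 (g11), 2026-09-02.
Road M6 «ROW 2 ★ DYADIC TWIN» (LEAD F0P3a-plan (g15) T14-66 ROAD-LIMITED; dealer LH4-plan (g8) WORD #38∕#42), brick (O4-G) «GLUED-LATTICE STRUCTURE LEMMA», FILE 2 of 2.
-/
import Literature.NumberTheory.Automorphic.GluedLatticeCyclic   -- ★ FILE 1 (this seat): §1 cyclic `U`-projection, (G) structure lemma, (D) self-duality ⇒ gluing hypothesis
import Mathlib.LinearAlgebra.LinearIndependent.Lemmas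
import Mathlib.Tactic.LinearCombination
import Mathlib.Tactic.FieldSimp
import HarnessLib

/-!
# Rank-two lattices in a quadratic algebra are principal over their (monogenic) multiplier order; (O4-G) assembled

Topic `NumberTheory/Automorphic`; namespace `Literature.NumberTheory.Automorphic`.  THEOREMS ONLY (no definition, no instance, no notation, no named fact, no `sorry`).
Cell `pub/hodgecm-mathlib` (D-0151), crux H413 = `stmt-HodgeConjecture-24833`; road M6 «ROW 2 ★ DYADIC TWIN», brick **(O4-G)** FILE 2 (FILE 1 = ★ `GluedLatticeCyclic`).
Currency as FILE 1: `E` with `ValuativeRel E` (`𝒪 = 𝒪[E]`), `K` any field with `[Algebra E K]` (the `K₂`-line of a type-(2) commutant `E × K`), lattices `Submodule 𝒪[E] K`,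
multipliers by the pointwise `•`.  NO valuation on `K`, NO henselianity, NO `2`, NO different: the «quadratic» input is one element `ξ` with `ξ² = sξ − m` (`s, m ∈ E`)
and `1, ξ` independent over `E`.
HONEST LABEL: HC_CM is proved only modulo the 2 remaining named inputs (hLiu418 24832, h413 24833) until rung 0 closes; elementary module theory over a valuation ring,
asserts nothing printed; count-neutral base-layer brick ((O4) is not an organ).

THE MATHEMATICS.  (§1) For `L = 𝒪·1 ⊕ 𝒪·ξ`: coordinates are unique, and the MULTIPLIER ORDER is `O(L) = {α + βξ | α, β, βm, βs ∈ 𝒪}`.  (§2) (Q): choose `d ∈ {1, m, s}` of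
maximal valuation and `y ∈ {1, ξ, 1 + ξ}` with `v(N y) = v d` (`N(γ + δξ) = γ² + sγδ + mδ²`; the third case is the strict ultrametric `v(1 + s + m) = v s`); then
`O(L) = 𝒪·1 ⊕ 𝒪·d⁻¹ξ` is MONOGENIC and `L = O(L)·y` is PRINCIPAL — uniformly: for `x = α + βξ` the multiplier is `(A + Bξ)∕N(y)`, `A = α(γ + δs) + βδm`, `B = βγ − αδ`,
integral because `v A ≤ max(1, v s, v m) = v(N y)`.  (Q′) transports this to any `L = 𝒪a ⊕ 𝒪b` by the homothety `a⁻¹`.  This is the classical «orders in quadratic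
algebras are Bass orders: every lattice is invertible over its own multiplier ring», proved here by hand for an arbitrary valuation ring.  (§3) THE ASSEMBLED HEAD (O4-G):
a self-dual (for an orthogonal pairing with adjoint map, FILE 1 §3) glued lattice `Λ ≤ E × K` with finitely generated `U`-projection and rank-two `W`-projection is
`Λ = O(Λ)·v` — CYCLIC, hence invertible, over its own multiplier ring; this is FINDING #18's lemma (O4-G) for hyperspecial vertices, every type-(2) order, every
residue characteristic, and it makes every stratum of ENGINE-CENSUS «(O4) M6» §3 a torsor (the F3 «TOT-Λ» re-price input).

* §1 `quadCoord_unique`, `mem_span_one_pair_iff_valuationInteger`, `smul_span_one_pair_le_iff` (the multiplier order).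
* §2 `exists_multiplier_mul_eq_of_norm` (uniform generator verification), **`exists_generator_quadLattice`** (Q), `exists_generator_quadLattice'` (Q′).
* §3 **`exists_generator_of_selfDual_glued`** ((O4-G) assembled).

## References
* [Jacobowitz1962] R. Jacobowitz, *Hermitian forms over local fields*, Amer. J. Math. 84 (1962): §4, §7 (lattices in quadratic extensions, unimodular lattices).
* [Serre1980Trees] J.-P. Serre, *Trees* (1980): Ch. II §1.1 (lattices over valuation rings, classes, stabilisers).
* [Bass1963] H. Bass, *On the ubiquity of Gorenstein rings*, Math. Z. 82 (1963): §7 (orders in quadratic algebras are Gorenstein∕Bass; context, re-proved here by hand).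
* [Cox2013] D. A. Cox, *Primes of the form x² + ny²*, 2nd ed. (2013): §7.A Lemma 7.5, Prop. 7.4 (the `ℤ`-version: `[1, τ]` is proper, proper = invertible; ★ `QuadraticOrdersInvertibleLattices`).
-/

set_option autoImplicit false

open scoped ValuativeRel Pointwise

namespace Literature.NumberTheory.Automorphic

variable {E : Type*} [Field E] [ValuativeRel E] {K : Type*} [Field K] [Algebra E K]

/-! ## §1 Coordinates in `L = 𝒪·1 ⊕ 𝒪·ξ` and the multiplier order -/

omit [ValuativeRel E] in
/-- Coordinates with respect to the `E`-basis `(1, ξ)` are unique. [cite: Serre1980Trees, II.1.1] -/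
theorem quadCoord_unique {ξ : K} (hli : LinearIndependent E ![(1 : K), ξ]) {α β α' β' : E}
    (h : algebraMap E K α + algebraMap E K β * ξ = algebraMap E K α' + algebraMap E K β' * ξ) : α = α' ∧ β = β' := by
  have h0 : (α - α') • (1 : K) + (β - β') • ξ = 0 := by
    simp only [Algebra.smul_def, mul_one, map_sub]
    linear_combination h
  obtain ⟨h1, h2⟩ := LinearIndependent.pair_iff.1 hli _ _ h0
  exact ⟨sub_eq_zero.1 h1, sub_eq_zero.1 h2⟩

/-- Membership in `L = span 𝒪 {1, ξ}`: `x ∈ L ↔ x = α + βξ` with `α, β ∈ 𝒪`. [cite: Serre1980Trees, II.1.1] -/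
theorem mem_span_one_pair_iff_valuationInteger (ξ x : K) :
    x ∈ Submodule.span 𝒪[E] ({1, ξ} : Set K) ↔
      ∃ α β : E, ValuativeRel.valuation E α ≤ 1 ∧ ValuativeRel.valuation E β ≤ 1 ∧ x = algebraMap E K α + algebraMap E K β * ξ := by
  rw [Submodule.mem_span_pair]
  constructor
  · rintro ⟨a, b, rfl⟩
    refine ⟨a, b, (Valuation.mem_integer_iff _ _).1 a.2, (Valuation.mem_integer_iff _ _).1 b.2, ?_⟩
    simp only [Algebra.smul_def, IsScalarTower.algebraMap_apply 𝒪[E] E K, mul_one]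
    rfl
  · rintro ⟨α, β, hα, hβ, rfl⟩
    refine ⟨⟨α, (Valuation.mem_integer_iff _ _).2 hα⟩, ⟨β, (Valuation.mem_integer_iff _ _).2 hβ⟩, ?_⟩
    simp only [Algebra.smul_def, IsScalarTower.algebraMap_apply 𝒪[E] E K, mul_one]
    rfl

/-- **The multiplier order of `L = 𝒪 ⊕ 𝒪ξ`** (`ξ² = sξ − m`): `a • L ≤ L ⟺ a = α + βξ` with `α, β, βm, βs ∈ 𝒪`. [cite: Jacobowitz1962, §7] [cite: Serre1980Trees, II.1.1] -/
theorem smul_span_one_pair_le_iff (ξ : K) (s m : E) (hξ : ξ * ξ = algebraMap E K s * ξ - algebraMap E K m)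
    (hli : LinearIndependent E ![(1 : K), ξ]) (a : K) :
    a • Submodule.span 𝒪[E] ({1, ξ} : Set K) ≤ Submodule.span 𝒪[E] ({1, ξ} : Set K) ↔
      ∃ α β : E, a = algebraMap E K α + algebraMap E K β * ξ ∧ ValuativeRel.valuation E α ≤ 1 ∧ ValuativeRel.valuation E β ≤ 1 ∧
        ValuativeRel.valuation E (β * m) ≤ 1 ∧ ValuativeRel.valuation E (β * s) ≤ 1 := by
  set L := Submodule.span 𝒪[E] ({1, ξ} : Set K) with hL
  have h1L : (1 : K) ∈ L := Submodule.subset_span (by simp)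
  have hξL : ξ ∈ L := Submodule.subset_span (by simp)
  constructor
  · intro h
    have haL : a ∈ L := by simpa using h (Submodule.smul_mem_pointwise_smul _ a L h1L)
    have haξL : a * ξ ∈ L := h (Submodule.smul_mem_pointwise_smul _ a L hξL)
    obtain ⟨α, β, hα, hβ, rfl⟩ := (mem_span_one_pair_iff_valuationInteger ξ a).1 haL
    obtain ⟨γ, δ, hγ, hδ, hγδ⟩ := (mem_span_one_pair_iff_valuationInteger ξ _).1 haξL
    -- `(α + βξ)ξ = -βm + (α + βs)ξ`
    have hprod : (algebraMap E K α + algebraMap E K β * ξ) * ξ = algebraMap E K (-(β * m)) + algebraMap E K (α + β * s) * ξ := by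
      simp only [map_neg, map_mul, map_add]
      linear_combination (algebraMap E K β) * hξ
    rw [hprod] at hγδ
    obtain ⟨h1, h2⟩ := quadCoord_unique hli hγδ
    refine ⟨α, β, rfl, hα, hβ, ?_, ?_⟩
    · have : ValuativeRel.valuation E (-(β * m)) ≤ 1 := h1 ▸ hγ
      rwa [Valuation.map_neg] at this
    · have hs : ValuativeRel.valuation E (α + β * s) ≤ 1 := h2 ▸ hδ
      -- `βs = (α + βs) - α`
      have := Valuation.map_sub_le (ValuativeRel.valuation E) hs hα
      rwa [add_sub_cancel_left] at this
  · rintro ⟨α, β, rfl, hα, hβ, hβm, hβs⟩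
    refine (pointwise_smul_le_iff_forall _ L L).2 fun x hx => ?_
    obtain ⟨γ, δ, hγ, hδ, rfl⟩ := (mem_span_one_pair_iff_valuationInteger ξ x).1 hx
    rw [smul_eq_mul, mem_span_one_pair_iff_valuationInteger]
    refine ⟨α * γ - β * δ * m, α * δ + β * γ + β * δ * s, ?_, ?_, ?_⟩
    · refine Valuation.map_sub_le _ ?_ ?_
      · rw [map_mul]; exact mul_le_one' hα hγ
      · rw [show β * δ * m = (β * m) * δ by ring, map_mul]; exact mul_le_one' hβm hδ
    · refine Valuation.map_add_le _ (Valuation.map_add_le _ ?_ ?_) ?_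
      · rw [map_mul]; exact mul_le_one' hα hδ
      · rw [map_mul]; exact mul_le_one' hβ hγ
      · rw [show β * δ * s = (β * s) * δ by ring, map_mul]; exact mul_le_one' hβs hδ
    · simp only [map_sub, map_mul, map_add]
      linear_combination (algebraMap E K β * algebraMap E K δ) * hξ

/-! ## §2 (Q) `L = 𝒪 ⊕ 𝒪ξ` is principal over its multiplier order `𝒪 ⊕ 𝒪·d⁻¹ξ` -/

/-- **The generator, uniform verification.**  If `y = γ + δξ ∈ L` (`γ, δ ∈ 𝒪`) has norm `n = γ² + sγδ + mδ²` with `v n ≥ 1, v m, v s` (so `v n = max(1, |m|, |s|)`), then every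
`x ∈ L` is `a·y` with `a ∈ O(L)`: explicitly `a = (A + Bξ)∕n`, `A = α(γ + δs) + βδm`, `B = βγ − αδ` for `x = α + βξ`. [cite: Jacobowitz1962, §7] [cite: Serre1980Trees, II.1.1] -/
theorem exists_multiplier_mul_eq_of_norm (ξ : K) (s m : E) (hξ : ξ * ξ = algebraMap E K s * ξ - algebraMap E K m)
    (hli : LinearIndependent E ![(1 : K), ξ]) (γ δ : E) (hγ : ValuativeRel.valuation E γ ≤ 1) (hδ : ValuativeRel.valuation E δ ≤ 1)
    (hn1 : 1 ≤ ValuativeRel.valuation E (γ * γ + s * γ * δ + m * δ * δ))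
    (hnm : ValuativeRel.valuation E m ≤ ValuativeRel.valuation E (γ * γ + s * γ * δ + m * δ * δ))
    (hns : ValuativeRel.valuation E s ≤ ValuativeRel.valuation E (γ * γ + s * γ * δ + m * δ * δ))
    (x : K) (hx : x ∈ Submodule.span 𝒪[E] ({1, ξ} : Set K)) :
    ∃ a : K, a • Submodule.span 𝒪[E] ({1, ξ} : Set K) ≤ Submodule.span 𝒪[E] ({1, ξ} : Set K) ∧
      x = a * (algebraMap E K γ + algebraMap E K δ * ξ) := by
  set v := ValuativeRel.valuation E with hv
  set n : E := γ * γ + s * γ * δ + m * δ * δ with hn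
  have hn0 : n ≠ 0 := by
    intro h; rw [h, map_zero] at hn1; exact not_lt.2 hn1 zero_lt_one
  obtain ⟨α, β, hα, hβ, rfl⟩ := (mem_span_one_pair_iff_valuationInteger ξ x).1 hx
  set A : E := α * (γ + δ * s) + β * δ * m with hA
  set B : E := β * γ - α * δ with hB
  refine ⟨algebraMap E K (A / n) + algebraMap E K (B / n) * ξ, ?_, ?_⟩
  · rw [smul_span_one_pair_le_iff ξ s m hξ hli]
    refine ⟨A / n, B / n, rfl, ?_, ?_, ?_, ?_⟩
    · -- `v A ≤ max(1, v s, v m) ≤ v n`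
      rw [map_div₀, div_le_one₀ (lt_of_lt_of_le zero_lt_one hn1)]
      refine Valuation.map_add_le _ ?_ ?_
      · rw [map_mul]
        refine mul_le_of_le_one_of_le hα (Valuation.map_add_le _ (le_trans hγ hn1) ?_)
        rw [map_mul]; exact mul_le_of_le_one_of_le hδ hns
      · rw [map_mul, map_mul]
        exact mul_le_of_le_one_of_le (mul_le_one' hβ hδ) hnm
    · rw [map_div₀, div_le_one₀ (lt_of_lt_of_le zero_lt_one hn1)]
      refine le_trans (Valuation.map_sub_le _ ?_ ?_) hn1
      · rw [map_mul]; exact mul_le_one' hβ hγ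
      · rw [map_mul]; exact mul_le_one' hα hδ
    · rw [div_mul_eq_mul_div, map_div₀, div_le_one₀ (lt_of_lt_of_le zero_lt_one hn1), map_mul]
      refine mul_le_of_le_one_of_le (Valuation.map_sub_le _ ?_ ?_) hnm
      · rw [map_mul]; exact mul_le_one' hβ hγ
      · rw [map_mul]; exact mul_le_one' hα hδ
    · rw [div_mul_eq_mul_div, map_div₀, div_le_one₀ (lt_of_lt_of_le zero_lt_one hn1), map_mul]
      refine mul_le_of_le_one_of_le (Valuation.map_sub_le _ ?_ ?_) hns
      · rw [map_mul]; exact mul_le_one' hβ hγ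
      · rw [map_mul]; exact mul_le_one' hα hδ
  · -- the identity `(A + Bξ)(γ + δξ) = n (α + βξ)` divided by `n`
    have hnK : algebraMap E K n ≠ 0 := by simpa using hn0
    have key : (algebraMap E K A + algebraMap E K B * ξ) * (algebraMap E K γ + algebraMap E K δ * ξ) =
        algebraMap E K n * (algebraMap E K α + algebraMap E K β * ξ) := by
      simp only [hA, hB, hn, map_add, map_mul, map_sub]
      linear_combination ((algebraMap E K β * algebraMap E K γ - algebraMap E K α * algebraMap E K δ) * algebraMap E K δ) * hξ
    have hdiv : algebraMap E K (A / n) + algebraMap E K (B / n) * ξ = (algebraMap E K n)⁻¹ * (algebraMap E K A + algebraMap E K B * ξ) := by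
      simp only [map_div₀]
      field_simp
    rw [hdiv, mul_assoc, key, ← mul_assoc, inv_mul_cancel₀ hnK, one_mul]

/-- **(Q) A rank-two lattice `L = 𝒪 ⊕ 𝒪ξ` (`ξ² = sξ − m`, `1, ξ` independent over `E`) is PRINCIPAL over its multiplier order, which is MONOGENIC** (the valuation-ring twin of Cox's Lemma 7.5 ∕ Prop. 7.4 «`[1, τ]` is proper = invertible for the order `[1, aτ]`», ★ `Literature.NumberTheory.QuadraticFields.QuadraticLattice` over `ℤ`): there is `d ≠ 0`
(`d ∈ {1, m, s}` of maximal valuation) with `O(L) = {a | a • L ≤ L} = 𝒪·1 ⊕ 𝒪·d⁻¹ξ`, and `L = O(L)·y` for some `y ∈ L` (`y ∈ {1, ξ, 1 + ξ}` with `v(N y) = v d`).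
No valuation on `K`, no henselianity, any residue characteristic. [cite: Cox2013, §7.A Lemma 7.5, Prop. 7.4 pp. 134–136] [cite: Jacobowitz1962, §7] [cite: Serre1980Trees, II.1.1] [cite: Bass1963, §7] -/
theorem exists_generator_quadLattice (ξ : K) (s m : E) (hξ : ξ * ξ = algebraMap E K s * ξ - algebraMap E K m)
    (hli : LinearIndependent E ![(1 : K), ξ]) :
    ∃ d : E, d ≠ 0 ∧
      (∀ a : K, a • Submodule.span 𝒪[E] ({1, ξ} : Set K) ≤ Submodule.span 𝒪[E] ({1, ξ} : Set K) ↔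
        a ∈ Submodule.span 𝒪[E] ({1, algebraMap E K d⁻¹ * ξ} : Set K)) ∧
      ∃ y ∈ Submodule.span 𝒪[E] ({1, ξ} : Set K), ∀ x ∈ Submodule.span 𝒪[E] ({1, ξ} : Set K),
        ∃ a : K, a • Submodule.span 𝒪[E] ({1, ξ} : Set K) ≤ Submodule.span 𝒪[E] ({1, ξ} : Set K) ∧ x = a * y := by
  set v := ValuativeRel.valuation E with hv
  -- choose `(d, γ, δ)` with `v d = max(1, v m, v s)` and `y = γ + δξ` of norm valuation `v d`
  have hchoice : ∃ d γ δ : E, (d = 1 ∨ d = m ∨ d = s) ∧ 1 ≤ v d ∧ v m ≤ v d ∧ v s ≤ v d ∧ v γ ≤ 1 ∧ v δ ≤ 1 ∧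
      v (γ * γ + s * γ * δ + m * δ * δ) = v d := by
    by_cases h1 : v m ≤ 1 ∧ v s ≤ 1
    · exact ⟨1, 1, 0, Or.inl rfl, by simp, by simpa using h1.1, by simpa using h1.2, by simp, by simp, by simp⟩
    · by_cases h2 : v s ≤ v m
      · -- `d = m`, `y = ξ`
        have hm1 : 1 ≤ v m := by
          rw [not_and_or] at h1
          rcases h1 with h | h
          · exact (not_le.1 h).le
          · exact le_trans (not_le.1 h).le h2
        exact ⟨m, 0, 1, Or.inr (Or.inl rfl), hm1, le_rfl, h2, by simp, by simp, by simp⟩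
      · -- `d = s`, `y = 1 + ξ`, `N y = 1 + s + m` with `v s > max(1, v m)`
        have hsm : v m < v s := not_le.1 h2
        have hs1 : 1 < v s := by
          rw [not_and_or] at h1
          rcases h1 with h | h
          · exact lt_trans (not_le.1 h) hsm
          · exact not_le.1 h
        refine ⟨s, 1, 1, Or.inr (Or.inr rfl), hs1.le, hsm.le, le_rfl, by simp, by simp, ?_⟩
        have : (1 : E) * 1 + s * 1 * 1 + m * 1 * 1 = s + (1 + m) := by ring
        rw [this]
        refine Valuation.map_add_eq_of_lt_left _ ?_
        calc v (1 + m) ≤ max (v 1) (v m) := Valuation.map_add _ _ _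
          _ < v s := max_lt (by simpa using hs1) hsm
  obtain ⟨d, γ, δ, hdcase, hd1, hdm, hds, hγ, hδ, hN⟩ := hchoice
  have hd0 : d ≠ 0 := by intro h; rw [h, map_zero] at hd1; exact not_lt.2 hd1 zero_lt_one
  have hvd0 : 0 < v d := lt_of_lt_of_le zero_lt_one hd1
  refine ⟨d, hd0, fun a => ?_, ?_⟩
  · -- the multiplier order: `α + βξ` with `α, β, βm, βs ∈ 𝒪` ⟺ `α ∈ 𝒪`, `βd ∈ 𝒪`
    rw [smul_span_one_pair_le_iff ξ s m hξ hli, Submodule.mem_span_pair]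
    constructor
    · rintro ⟨α, β, rfl, hα, hβ, hβm, hβs⟩
      have hβd : v (β * d) ≤ 1 := by
        rcases hdcase with rfl | rfl | rfl
        · simpa using hβ
        · exact hβm
        · exact hβs
      refine ⟨⟨α, (Valuation.mem_integer_iff _ _).2 hα⟩, ⟨β * d, (Valuation.mem_integer_iff _ _).2 hβd⟩, ?_⟩
      simp only [Algebra.smul_def, mul_one]
      change algebraMap E K α + algebraMap E K (β * d) * (algebraMap E K d⁻¹ * ξ) = _
      rw [map_mul, map_inv₀, mul_assoc (algebraMap E K β), ← mul_assoc (algebraMap E K d),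
        mul_inv_cancel₀ (by simpa using hd0), one_mul]
    · rintro ⟨a', b', rfl⟩
      have ha' := (Valuation.mem_integer_iff _ _).1 a'.2
      have hb' := (Valuation.mem_integer_iff _ _).1 b'.2
      refine ⟨a', (b' : E) / d, ?_, ha', ?_, ?_, ?_⟩
      · simp only [Algebra.smul_def, mul_one, map_mul, map_inv₀, div_eq_mul_inv, mul_assoc]
        rfl
      · rw [map_div₀]; exact div_le_one_of_le₀ (hb'.trans hd1) zero_le
      · rw [div_mul_eq_mul_div, map_div₀, map_mul]
        exact div_le_one_of_le₀ (mul_le_of_le_one_of_le hb' hdm) zero_le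
      · rw [div_mul_eq_mul_div, map_div₀, map_mul]
        exact div_le_one_of_le₀ (mul_le_of_le_one_of_le hb' hds) zero_le
  · refine ⟨algebraMap E K γ + algebraMap E K δ * ξ, (mem_span_one_pair_iff_valuationInteger ξ _).2 ⟨γ, δ, hγ, hδ, rfl⟩, fun x hx => ?_⟩
    exact exists_multiplier_mul_eq_of_norm ξ s m hξ hli γ δ hγ hδ (hN ▸ hd1) (hN ▸ hdm) (hN ▸ hds) x hx

/-- **(Q′) Any rank-two lattice `L = 𝒪a ⊕ 𝒪b` in the quadratic algebra is principal over its multiplier order** (reduce to (Q) by the homothety `a⁻¹`: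
`L = a • (𝒪 ⊕ 𝒪ξ)`, `ξ = b∕a`, and homotheties do not change multipliers). [cite: Jacobowitz1962, §7] [cite: Serre1980Trees, II.1.1] -/
theorem exists_generator_quadLattice' (a b : K) (ha : a ≠ 0) (s m : E)
    (hξ : (b / a) * (b / a) = algebraMap E K s * (b / a) - algebraMap E K m) (hli : LinearIndependent E ![a, b]) :
    ∃ y ∈ Submodule.span 𝒪[E] ({a, b} : Set K), ∀ x ∈ Submodule.span 𝒪[E] ({a, b} : Set K),
      ∃ c : K, c • Submodule.span 𝒪[E] ({a, b} : Set K) ≤ Submodule.span 𝒪[E] ({a, b} : Set K) ∧ x = c * y := by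
  set ξ : K := b / a with hξdef
  set L := Submodule.span 𝒪[E] ({1, ξ} : Set K) with hL
  -- `1, ξ` are independent
  have hli' : LinearIndependent E ![(1 : K), ξ] := by
    refine LinearIndependent.pair_iff.2 fun s' t' h => ?_
    have h' : s' • a + t' • b = 0 := by
      have := congrArg (fun z => z * a) h
      simpa [add_mul, smul_mul_assoc, hξdef, div_mul_cancel₀ b ha] using this
    exact LinearIndependent.pair_iff.1 hli s' t' h'
  -- `span {a, b} = a • L`
  have hab : Submodule.span 𝒪[E] ({a, b} : Set K) = a • L := by
    rw [hL, Submodule.pointwise_smul_def, Submodule.map_span]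
    congr 1
    ext z
    simp only [Set.image_insert_eq, Set.image_singleton, DistribSMul.toLinearMap_apply, smul_eq_mul, mul_one, hξdef,
      mul_div_cancel₀ b ha]
  obtain ⟨d, hd0, -, y, hyL, hgen⟩ := exists_generator_quadLattice ξ s m hξ hli'
  refine ⟨a * y, ?_, fun x hx => ?_⟩
  · rw [hab]; exact Submodule.smul_mem_pointwise_smul y a L hyL
  · rw [hab] at hx
    obtain ⟨x₀, hx₀, rfl⟩ := (Submodule.mem_smul_pointwise_iff_exists _ _ _).1 hx
    obtain ⟨c, hcL, rfl⟩ := hgen x₀ hx₀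
    refine ⟨c, ?_, by rw [smul_eq_mul]; ring⟩
    rw [hab, smul_comm]
    exact Submodule.map_mono hcL

/-! ## §3 (O4-G) assembled: a self-dual glued lattice with quadratic `W`-projection is cyclic over its multiplier ring -/

/-- **(O4-G) «GLUED-LATTICE STRUCTURE LEMMA», ASSEMBLED HEAD.**  Let `Λ ≤ E × K` be an `𝒪`-lattice whose `U`-projection is finitely generated and whose `W`-projection is a
rank-two lattice `𝒪a ⊕ 𝒪b` in the quadratic algebra (`(b∕a)² = s(b∕a) − m`), and let `Λ = Λ^#` for an ORTHOGONAL pairing `P` (`P m′ (0, x′) = T m′.2 x′`) with an adjoint map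
`†` (`T x (c x′) = T (c† x) x′`) such that the multiplier order of `pr_W Λ` is `†`-stable.  Then `Λ = O(Λ)·v` for some `v ∈ Λ`: `Λ` is CYCLIC, hence invertible, over its
own multiplier ring — FINDING #18's (O4-G) on hyperspecial vertices, for every type-(2) order and every residue characteristic (no `2`, no different, no Gorenstein theory).
Inputs: §1 of FILE 1 (cyclic `U`-projection), (Q′) (principal `W`-projection), (D) of FILE 1 (`J = L^#` is `O(L)`-stable), and the structure lemma `exists_generator_of_glued`.
[cite: Jacobowitz1962, §4, §7] [cite: Serre1980Trees, II.1.1] [cite: Bass1963, §7] -/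
theorem exists_generator_of_selfDual_glued (Λ : Submodule 𝒪[E] (E × K))
    (hfg : (Λ.map ((LinearMap.fst E E K).restrictScalars 𝒪[E])).FG)
    (a b : K) (ha : a ≠ 0) (s m : E) (hξ : (b / a) * (b / a) = algebraMap E K s * (b / a) - algebraMap E K m)
    (hli : LinearIndependent E ![a, b]) (hL : Λ.map ((LinearMap.snd E E K).restrictScalars 𝒪[E]) = Submodule.span 𝒪[E] ({a, b} : Set K))
    (P : E × K → E × K → E) (T : K → K → E) (dag : K → K)
    (hPT : ∀ (m' : E × K) (x' : K), P m' (0, x') = T m'.2 x')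
    (hT : ∀ (c x x' : K), T x (c * x') = T (dag c * x) x')
    (hsd : ∀ m' : E × K, m' ∈ Λ ↔ ∀ m'' ∈ Λ, P m'' m' ∈ 𝒪[E])
    (hdag : ∀ c : K, c • Λ.map ((LinearMap.snd E E K).restrictScalars 𝒪[E]) ≤ Λ.map ((LinearMap.snd E E K).restrictScalars 𝒪[E]) →
      dag c • Λ.map ((LinearMap.snd E E K).restrictScalars 𝒪[E]) ≤ Λ.map ((LinearMap.snd E E K).restrictScalars 𝒪[E])) :
    ∃ v ∈ Λ, ∀ x ∈ Λ, ∃ c : E × K, c • Λ ≤ Λ ∧ x = c * v := by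
  obtain ⟨u₀, hu₀⟩ := exists_eq_span_singleton_of_fg_valuationInteger _ hfg
  obtain ⟨t, htL, hgen⟩ := exists_generator_quadLattice' a b ha s m hξ hli
  rw [← hL] at htL hgen
  exact exists_generator_of_glued Λ ⟨u₀, hu₀⟩ t htL hgen
    (fun c hc => smul_comap_inr_le_of_selfDual Λ P T dag hPT hT hsd hdag c hc)

end Literature.NumberTheory.Automorphic
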